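import Literature.AlgebraicGeometry.HodgeTheory.BettiQuadricHypersurfaceHodgeTateProducts
import Literature.AlgebraicGeometry.HodgeTheory.BettiNumbersEulerCharacteristic
import HarnessLib

/-!
# The off-middle Betti numbers of a smooth hypersurface are `1, 0, 1, 0, …`; the PICARD NUMBER of a smooth hypersurface of dimension `≥ 3` is `1`; the topological EULER CHARACTERISTIC
# `E(Y) = m + b_m` (`m` even) ∕ `m + 1 − b_m` (`m` odd), in closed form `E(Y^{2r}_d) = ((d−1)^{2r+2} + (d−1))/d + 2r + 1` (Eisenbud–Harris 2016 Example 5.24, Table 5.1; Voisin II Cor. 1.24–1.25)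

Family `hodge`, lane `lit-hodgefound` (Track 2 foundations library; Layers A1/A4), layer `Literature/AlgebraicGeometry/HodgeTheory`.  THEOREMS ONLY (no definition, no named fact, no instance,
no notation; D-0026 net debt `0`).  Prover seat `lit-hodgefound-p21` (generation 41, row g41-#5), sequel of g41-#2 (the middle Betti number in closed form) and g41-#4 (quadrics).

THE MATHEMATICS.  Let `Y ⊂ ℙ^{m+1}_ℂ` be a smooth hypersurface (`IsSmoothHypersurface m d Y`: smooth projective, reduced, closed-immersed by `ι` onto `V₊(F)`, `F` irreducible of degree `d`).  By the
Lefschetz hyperplane theorem `ι^* : Hᵏ(ℙ^{m+1}; ℂ) → Hᵏ(Y(ℂ); ℂ)` is an isomorphism for `k < m` (Voisin II Thm. 1.23, Cor. 1.24; in the tree: surjective below the middle, `surjective_map_of_lt`,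
and injective on `H^{2p}(ℙ^{m+1}) = ℂ · hᵖ` because `ι^* hᵖ ≠ 0`, `map_ne_zero_of_le` — `hᵖ ∪ h^{m−p}` integrates to `deg Y ≠ 0`), so **`b_{2p}(Y) = 1` for `2p < m`**, and by Poincaré duality
`b_{2p} = b_{2m−2p}` also for `m < 2p ≤ 2m` (§1): «the Betti numbers other than `b_{n−1}` are `1` in even dimensions and `0` in odd» (Eisenbud–Harris; the odd ones are the tree's
`IsSmoothHypersurface.finrank_bettiCohomology_eq_zero_of_odd`).  Since `H^{2p}(Y;ℚ) = Hdgᵖ` off the middle (p29), **`h^{p,p}(H^{2p}(Y)) = 1 = dim_ℚ Hdgᵖ(H^{2p}(Y)) = dim_ℂ Nᵖ(Y)`** for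
`2p ≠ m` (Arapura §17.3: «`h^{pq}(X) = δ_{pq}` when `n−1 ≠ p+q`»), in particular **THE PICARD NUMBER OF A SMOOTH HYPERSURFACE OF DIMENSION `m ≥ 3` IS `ρ(Y) = 1`** (§2; Grothendieck–Lefschetz
`Pic Y = ℤ · 𝒪_Y(1)` read on the rational Betti carriers).  Summing, the topological Euler characteristic `E(Y) = Σ_k (−1)^k b_k(Y)` is **`m + b_m(Y)` for `m` even and `m + 1 − b_m(Y)` for `m`
odd** (§3; the Poincaré folding `E = 2 Σ_{k<m} (−1)^k b_k + (−1)^m b_m` of the tree with `Σ_{k<m} (−1)^k b_k = ⌈m/2⌉`), so with the closed form of g41-#2: **`E(Y) = ((d−1)^{m+2} + (d−1))/d + m + 1`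
for even `m`** — Eisenbud–Harris' `χ_top(X) = deg c_{n−1}(T_X) = Σ_{i=0}^{n−1} (−1)^i C(n+1, n−1−i) d^{i+1}` `= ((1−d)^{n+1} − 1)/d + n + 1` for a hypersurface in `ℙⁿ` — and `E(Y) ≥ m + 1 − ((d−1)^{m+2} − (d−1))/d`
for odd `m` (equality in print; the tree's odd middle Betti number is one-sided), `E = m + 1` for odd-dimensional quadrics and hyperplanes.  Table 5.1: quadric∕cubic∕quartic surface `4, 9, 24`,
`E(S_d) = d³ − 4d² + 6d`; quadric∕cubic threefold `4, −6`; quadric∕cubic fourfold `6, 27`.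

THE PRINTS.  D. Eisenbud, J. Harris (2016) [EisenbudHarris2016] §5.7 Example 5.24 and Table 5.1 (held text p0210–p0211).  C. Voisin (2003) [VoisinHodgeII2003] §1.2.2 Thm. 1.23, §1.2.3 Cor. 1.24 («`Hᵏ(X, ℤ) ≅
Hᵏ(ℙⁿ⁺¹, ℤ)` for `k < n`»), Cor. 1.25.  C. Voisin (2002) [VoisinHodgeI2002] §7.1.1, §11.1.2 Prop. 11.20, §11.3.1 Thm. 11.30.  D. Arapura (2012) [Arapura2012] §17.3 (held text p0248).  A. Hatcher (2002)
[HatcherAT2002] §3.3 Cor. 3.37 (Poincaré duality).  R. Hartshorne (1977) [Hartshorne1977] II Ex. 6.5 (d), III Ex. 11.6 (Grothendieck–Lefschetz for `Pic`).  F. Hirzebruch (1966) [Hirzebruch1966] §15.8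
Thm. 15.8.1.  D. Huybrechts (2016) [Huybrechts2016K3] Ch. 1 §2.3 (`e(X) = 24` for K3 surfaces).

THE OBJECTS (all the tree's).  `IsSmoothHypersurface`, `complexBetti`, `complexBetti.map`, `bettiCohomology`, `algebraicClasses`, `BettiUniverse.hodge hHD hX k` with `hodgeNumber`, `hodgeClasses`;
p20's `surjective_map_of_lt`, `map_ne_zero_of_le`, `finrank_complexBetti_projectiveSpace_two_mul` (`HypersurfaceLefschetzUpper`), `Voisin2003_smoothHypersurface_algebraicClasses_eq_top_holds`;
`finrank_complexBetti_eq_finrank_bettiCohomology`, `BettiUniverse.finrank_bettiCohomology_eq_of_add_eq`, `…finrank_bettiCohomology_eq_sum_hodgeNumber_hodge`, `…finrank_hodgeClasses_hodge_eq_finrank_iff`,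
`…eulerChar_eq_two_mul_sum_add`; p29's `IsSmoothHypersurface.finrank_bettiCohomology_eq_zero_of_odd`, `…hodgeClasses_hodge_eq_top_of_two_mul_ne`; the seat's g41-#2∕#3∕#4
`finrank_bettiCohomology_middle_even_eq_div`, `…odd_le_div`, `hodgeNumber_hodge_eq_zero_of_two_mul_ne`, `finrank_bettiCohomology_middle_eq_zero_of_degree_le_two`, `finrank_bettiCohomology_two_surface`,
`finrank_bettiCohomology_four_cubicFourfold`, `…quadricFourfold`.

WHAT IS PROVED.
* §1 **`IsSmoothHypersurface.finrank_complexBetti_two_mul_eq_one_of_lt`** (`2p < m`, complex coefficients), **`…finrank_bettiCohomology_two_mul_eq_one`** (`b_{2p} = 1`, `2p ≠ m`, `p ≤ m`), `…two_eq_one` (`b₂ = 1`, `m ≥ 3`),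
  `…zero_eq_one` (`b₀ = 1`), **`…hodgeNumber_hodge_diag_eq_one_of_two_mul_ne`** (`h^{p,p} = 1` off the middle).
* §2 **`IsSmoothHypersurface.finrank_hodgeClasses_hodge_eq_one_of_two_mul_ne`** (`dim Hdgᵖ = 1`), **`…finrank_hodgeClasses_hodge_two_eq_one`** (`ρ(Y) = 1`, `m ≥ 3`), **`…finrank_algebraicClasses_eq_one_of_two_mul_ne`** (`dim_ℂ Nᵖ(Y) = 1`).
* §3 `IsSmoothHypersurface.sum_range_neg_one_pow_mul_finrank_bettiCohomology` (`Σ_{k<m} (−1)^k b_k = ⌈m/2⌉`), **`…eulerChar_eq_of_even`** (`E = m + b_m`), **`…eulerChar_eq_of_odd`** (`E = m + 1 − b_m`),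
  **`…eulerChar_eq_div_of_even`** (closed form), `…le_eulerChar_of_odd`, `…eulerChar_eq_of_odd_of_degree_le_two` (`E = m + 1`), instances `eulerChar_cubicFourfold` (`27`), `…quadricFourfold` (`6`),
  `…cubicSurface` (`9`), `…quarticSurface` (`24`), **`…eulerChar_surface`** (`E(S_d) = d³ − 4d² + 6d`), `neg_six_le_eulerChar_cubicThreefold`, `eulerChar_quadricThreefold` (`4`).

DEVIATIONS / SCOPE.  Rational∕complex Betti numbers only (no torsion statement: the integral Lefschetz theorem is the tree's `HypersurfaceLefschetzIntegral`); the Picard number is `dim_ℚ Hdg¹(H²(Y;ℚ))`,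
not the rank of `Pic Y` as a scheme-theoretic group; equality `E = m + 1 − ((d−1)^{m+2} − (d−1))/d` in odd dimension is left as `≥`.  No definitions.

## References
* [EisenbudHarris2016] D. Eisenbud, J. Harris, *3264 and All That* (2016) — §5.7 Example 5.24 and Table 5.1 (held text p0210–p0211).
* [VoisinHodgeII2003] C. Voisin, *Hodge Theory and Complex Algebraic Geometry II* (2003) — §1.2.2 Thm. 1.23; §1.2.3 Cor. 1.24, Cor. 1.25.
* [VoisinHodgeI2002] C. Voisin, *Hodge Theory and Complex Algebraic Geometry I* (2002) — §7.1.1; §11.1.2 Prop. 11.20; §11.3.1 Thm. 11.30.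
* [Arapura2012] D. Arapura, *Algebraic Geometry over the Complex Numbers* (2012) — §17.3 (held text p0248).
* [HatcherAT2002] A. Hatcher, *Algebraic Topology* (2002) — §3.3 Cor. 3.37.
* [Hartshorne1977] R. Hartshorne, *Algebraic Geometry* (1977) — II Ex. 6.5 (d); III Ex. 11.6.
* [Hirzebruch1966] F. Hirzebruch, *Topological Methods in Algebraic Geometry* (1966) — §15.8 Thm. 15.8.1.
* [Huybrechts2016K3] D. Huybrechts, *Lectures on K3 Surfaces* (2016) — Ch. 1 §2.3.

## Provenance
Lane `lit-hodgefound` (Hodge path, Track 2), prover seat `lit-hodgefound-p21` (generation 41), self-proposed row g41-#5 (sequel of g41-#2∕#4; uses p20's `HypersurfaceLefschetzUpper`, p29's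
`BettiHodgeConjectureProductsOffMiddleAlgebraicFactor`, the hodge-nonav seats' `BettiNumbersEulerCharacteristic`).
-/

noncomputable section

open scoped TensorProduct
open CategoryTheory MonoidalCategory Module Finset Function
open Literature.AlgebraicTopology.SingularHomology

namespace Literature.AlgebraicGeometry.Motives.IsSmoothHypersurface

open Literature.AlgebraicGeometry.Motives
open Literature.AlgebraicGeometry.Motives.HodgeStructure
open Literature.AlgebraicGeometry.HodgeTheory
open AlgebraicGeometry

variable {m n e d : ℕ} {X Y Z S T : SchemeOver ℂ}

/-! ### §1 The off-middle even Betti numbers of a smooth hypersurface are `1` -/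

section OffMiddle

/-- **`dim_ℂ H^{2p}(Y(ℂ); ℂ) = 1` for `2p < dim Y`** on a smooth hypersurface `Y ⊂ ℙ^{m+1}_ℂ`: the restriction `H^{2p}(ℙ^{m+1}) → H^{2p}(Y)` is surjective below the middle (Lefschetz hyperplane
theorem, the tree's `surjective_map_of_lt`) and injective (`ι^* hᵖ ≠ 0`, the tree's `map_ne_zero_of_le`), and `H^{2p}(ℙ^{m+1}; ℂ) = ℂ`. [cite: VoisinHodgeII2003, §1.2.2 Thm. 1.23 and §1.2.3 Cor. 1.24]
[cite: EisenbudHarris2016, Example 5.24] -/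
theorem finrank_complexBetti_two_mul_eq_one_of_lt (hYh : IsSmoothHypersurface m e Y) {p : ℕ} (hp : 2 * p < m) : Module.finrank ℂ (complexBetti Y (2 * p)) = 1 := by
  obtain ⟨F, hF, hirr, hred, ι, hι, hrange⟩ := hYh.2
  haveI := hι
  haveI := hred
  have hsurj : Surjective (complexBetti.map ι (2 * p)).hom := surjective_map_of_lt hYh hF hirr ι hrange hp
  have hinj : Injective (complexBetti.map ι (2 * p)).hom := by
    rw [injective_iff_map_eq_zero]
    intro α hα
    by_contra h0
    exact map_ne_zero_of_le hYh.1 hF hirr hred ι hrange (p := p) (by omega) h0 hα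
  rw [← (LinearEquiv.ofBijective (complexBetti.map ι (2 * p)).hom ⟨hinj, hsurj⟩).finrank_eq]
  exact finrank_complexBetti_projectiveSpace_two_mul (N := m + 1) (k := p) (by omega)

/-- **`b_{2p}(Y) = 1` for every even degree `2p ≠ dim Y`, `0 ≤ 2p ≤ 2 dim Y`** on a smooth hypersurface `Y ⊂ ℙ^{m+1}_ℂ` (rational Betti numbers; below the middle by Lefschetz, above by Poincaré duality
`b_{2p} = b_{2m−2p}`): «the Betti numbers other than `b_{n−1}` are `1` in even dimensions and `0` in odd». [cite: EisenbudHarris2016, Example 5.24 (held text p0211)] [cite: VoisinHodgeII2003, §1.2.3 Cor. 1.24 and Cor. 1.25]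
[cite: HatcherAT2002, §3.3 Cor. 3.37] -/
theorem finrank_bettiCohomology_two_mul_eq_one (hYh : IsSmoothHypersurface m e Y) {p : ℕ} (hpm : p ≤ m) (h2p : 2 * p ≠ m) : Module.finrank ℚ (bettiCohomology Y (2 * p)) = 1 := by
  rcases Nat.lt_or_gt_of_ne h2p with hlt | hgt
  · rw [← finrank_complexBetti_eq_finrank_bettiCohomology]
    exact hYh.finrank_complexBetti_two_mul_eq_one_of_lt hlt
  · rw [BettiUniverse.finrank_bettiCohomology_eq_of_add_eq hYh.1 (k := 2 * p) (l := 2 * (m - p)) (by omega), ← finrank_complexBetti_eq_finrank_bettiCohomology]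
    exact hYh.finrank_complexBetti_two_mul_eq_one_of_lt (p := m - p) (by omega)

/-- **`b₂(Y) = 1` for a smooth hypersurface of dimension `m ≥ 3`.** [cite: EisenbudHarris2016, Example 5.24] [cite: VoisinHodgeII2003, §1.2.3 Cor. 1.24] -/
theorem finrank_bettiCohomology_two_eq_one (hYh : IsSmoothHypersurface m e Y) (hm : 3 ≤ m) : Module.finrank ℚ (bettiCohomology Y 2) = 1 :=
  hYh.finrank_bettiCohomology_two_mul_eq_one (p := 1) (by omega) (by omega)

/-- **`b₀(Y) = 1`** (a smooth hypersurface of dimension `m ≥ 1` is connected). [cite: VoisinHodgeII2003, §1.2.3 Cor. 1.24] [cite: HatcherAT2002, §3.3 Cor. 3.37] -/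
theorem finrank_bettiCohomology_zero_eq_one (hYh : IsSmoothHypersurface m e Y) (hm : 1 ≤ m) : Module.finrank ℚ (bettiCohomology Y 0) = 1 :=
  hYh.finrank_bettiCohomology_two_mul_eq_one (p := 0) (by omega) (by omega)

/-- **`h^{p,p}(H^{2p}(Y)) = 1` off the middle** (`2p ≠ dim Y`, `p ≤ dim Y`): `H^{2p}(Y;ℚ) = ℚ · hᵖ` is a line of Hodge classes. [cite: VoisinHodgeII2003, §1.2.3 Cor. 1.24 and Cor. 1.25] [cite: VoisinHodgeI2002, §7.1.1 and §11.3.1]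
[cite: Arapura2012, §17.3 (held text p0248: «the Hodge numbers `h^{pq}(X)` equal `δ_{pq}` when `n−1 ≠ p+q`»)] -/
theorem hodgeNumber_hodge_diag_eq_one_of_two_mul_ne (hYh : IsSmoothHypersurface m e Y) (hHD : exists_isReal_hodgeModel) (hX : IsSmoothProjective m Y) {p : ℕ} (hpm : p ≤ m) (h2p : 2 * p ≠ m) :
    (BettiUniverse.hodge hHD hX (2 * p)).hodgeNumber p p = 1 := by
  have hb := hYh.finrank_bettiCohomology_two_mul_eq_one hpm h2p
  rw [BettiUniverse.finrank_bettiCohomology_eq_sum_hodgeNumber_hodge hHD hX (2 * p), Finset.sum_eq_single_of_mem p (Finset.mem_range.2 (by omega))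
    (fun a _ hap ↦ hYh.hodgeNumber_hodge_eq_zero_of_two_mul_ne hHD hX h2p (by exact_mod_cast hap))] at hb
  rwa [show ((2 * p - p : ℕ) : ℤ) = (p : ℤ) by push_cast [show p ≤ 2 * p by omega]; ring] at hb

end OffMiddle

/-! ### §2 The Picard number of a smooth hypersurface of dimension `≥ 3` is `1` -/

section Picard

/-- **`dim_ℚ Hdgᵖ(H^{2p}(Y)) = 1` off the middle** (`2p ≠ dim Y`, `p ≤ dim Y`): the powers `hᵖ` of the hyperplane class. [cite: VoisinHodgeII2003, §1.2.3 Cor. 1.24 and Cor. 1.25] [cite: VoisinHodgeI2002, §11.3.1] -/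
theorem finrank_hodgeClasses_hodge_eq_one_of_two_mul_ne (hYh : IsSmoothHypersurface m e Y) (hHD : exists_isReal_hodgeModel) (hX : IsSmoothProjective m Y) {p : ℕ} (hpm : p ≤ m) (h2p : 2 * p ≠ m) :
    Module.finrank ℚ ↥((BettiUniverse.hodge hHD hX (2 * p)).hodgeClasses p) = 1 := by
  rw [(BettiUniverse.finrank_hodgeClasses_hodge_eq_finrank_iff hHD hX p).2 (hYh.hodgeClasses_hodge_eq_top_of_two_mul_ne hHD hX h2p)]
  exact hYh.finrank_bettiCohomology_two_mul_eq_one hpm h2p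

/-- **`ρ(Y) = 1` for every smooth hypersurface `Y ⊂ ℙ^{m+1}_ℂ` of dimension `m ≥ 3`** (`ρ = dim_ℚ Hdg¹(H²(Y))`; `H²(Y;ℚ) = ℚ · h` consists of divisor classes: Lefschetz' theorem `Pic Y = ℤ · 𝒪_Y(1)`
read on the rational Betti carriers). [cite: VoisinHodgeII2003, §1.2.3 Cor. 1.24 and Cor. 1.25] [cite: VoisinHodgeI2002, §11.3.1 Thm. 11.30] [cite: Hartshorne1977, II Ex. 6.5 (d) and III Ex. 11.6 (Grothendieck–Lefschetz)] -/
theorem finrank_hodgeClasses_hodge_two_eq_one (hYh : IsSmoothHypersurface m e Y) (hm : 3 ≤ m) (hHD : exists_isReal_hodgeModel) (hX : IsSmoothProjective m Y) :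
    Module.finrank ℚ ↥((BettiUniverse.hodge hHD hX 2).hodgeClasses 1) = 1 :=
  hYh.finrank_hodgeClasses_hodge_eq_one_of_two_mul_ne hHD hX (p := 1) (by omega) (by omega)

/-- **`dim_ℂ Nᵖ(Y) = 1` off the middle**: the algebraic classes of codimension `p` (`2p ≠ dim Y`, `p ≤ dim Y`) form the line `ℂ · hᵖ` (`Nᵖ(Y) = H^{2p}(Y;ℂ)`, Lefschetz).
[cite: VoisinHodgeII2003, §1.2.3 Cor. 1.24 and Cor. 1.25] [cite: VoisinHodgeI2002, §11.1.2 Prop. 11.20] -/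
theorem finrank_algebraicClasses_eq_one_of_two_mul_ne (hYh : IsSmoothHypersurface m e Y) {p : ℕ} (hpm : p ≤ m) (h2p : 2 * p ≠ m) : Module.finrank ℂ ↥(algebraicClasses Y p) = 1 := by
  rw [Voisin2003_smoothHypersurface_algebraicClasses_eq_top_holds.of_two_mul_ne hYh p h2p, finrank_top, finrank_complexBetti_eq_finrank_bettiCohomology]
  exact hYh.finrank_bettiCohomology_two_mul_eq_one hpm h2p

end Picard

/-! ### §3 The topological Euler characteristic of a smooth hypersurface: `E(Y) = m + b_m` (`m` even), `E(Y) = m + 1 − b_m` (`m` odd) -/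

section Euler

/-- The lower half of the Betti numbers: `Σ_{k < m} (−1)^k b_k(Y) = ⌈m/2⌉` (`b_k = 1` for even `k < m`, `0` for odd `k < m`). [cite: EisenbudHarris2016, Example 5.24] -/
theorem sum_range_neg_one_pow_mul_finrank_bettiCohomology (hYh : IsSmoothHypersurface m e Y) :
    ∑ k ∈ range m, (-1 : ℤ) ^ k * (Module.finrank ℚ (bettiCohomology Y k) : ℤ) = ((m + 1) / 2 : ℕ) := by
  have key : ∀ l : ℕ, l ≤ m → ∑ k ∈ range l, (-1 : ℤ) ^ k * (Module.finrank ℚ (bettiCohomology Y k) : ℤ) = ((l + 1) / 2 : ℕ) := by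
    intro l
    induction l with
    | zero => simp
    | succ l ih =>
      intro hl
      rw [Finset.sum_range_succ, ih (by omega)]
      rcases Nat.even_or_odd l with ⟨j, hj⟩ | ⟨j, hj⟩
      · rw [show l = 2 * j by omega, hYh.finrank_bettiCohomology_two_mul_eq_one (p := j) (by omega) (by omega), pow_mul, neg_one_sq, one_pow]
        rw [show (2 * j + 1 + 1) / 2 = j + 1 by omega, show (2 * j + 1) / 2 = j by omega]
        push_cast
        ring
      · rw [hYh.finrank_bettiCohomology_eq_zero_of_odd ⟨j, hj⟩ (by omega)]
        rw [show (l + 1 + 1) / 2 = (l + 1) / 2 by omega]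
        simp
  exact key m le_rfl

/-- **`E(Y) = m + b_m(Y)` for a smooth hypersurface of EVEN dimension `m`** (`E = Σ (−1)^k b_k`; the `m` off-middle even degrees contribute `1` each). [cite: EisenbudHarris2016, Example 5.24 and Table 5.1]
[cite: Hirzebruch1966, §15.8 Thm. 15.8.1] -/
theorem eulerChar_eq_of_even (hYh : IsSmoothHypersurface m e Y) (hm : Even m) :
    ∑ k ∈ range (2 * m + 1), (-1 : ℤ) ^ k * (Module.finrank ℚ (bettiCohomology Y k) : ℤ) = m + (Module.finrank ℚ (bettiCohomology Y m) : ℤ) := by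
  obtain ⟨r, hr⟩ := hm
  rw [BettiUniverse.eulerChar_eq_two_mul_sum_add hYh.1, hYh.sum_range_neg_one_pow_mul_finrank_bettiCohomology, hr, show (r + r + 1) / 2 = r by omega,
    show r + r = 2 * r by ring, pow_mul, neg_one_sq, one_pow]
  push_cast
  ring

/-- **`E(Y) = m + 1 − b_m(Y)` for a smooth hypersurface of ODD dimension `m`.** [cite: EisenbudHarris2016, Example 5.24 and Table 5.1] [cite: Hirzebruch1966, §15.8 Thm. 15.8.1] -/
theorem eulerChar_eq_of_odd (hYh : IsSmoothHypersurface m e Y) (hm : Odd m) :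
    ∑ k ∈ range (2 * m + 1), (-1 : ℤ) ^ k * (Module.finrank ℚ (bettiCohomology Y k) : ℤ) = m + 1 - (Module.finrank ℚ (bettiCohomology Y m) : ℤ) := by
  obtain ⟨r, hr⟩ := hm
  rw [BettiUniverse.eulerChar_eq_two_mul_sum_add hYh.1, hYh.sum_range_neg_one_pow_mul_finrank_bettiCohomology, hr, show (2 * r + 1 + 1) / 2 = r + 1 by omega, pow_succ, pow_mul,
    neg_one_sq, one_pow]
  push_cast
  ring

/-- **THE EULER CHARACTERISTIC OF A SMOOTH HYPERSURFACE OF EVEN DIMENSION in closed form: `E(Y) = ((d−1)^{m+2} + (d−1))/d + m + 1`** (`m = 2r ≥ 2`; Eisenbud–Harris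
`χ_top = Σ_{i=0}^{n−1} (−1)^i C(n+1, n−1−i) d^{i+1}` for a hypersurface in `ℙⁿ`; Table 5.1: quadric∕cubic∕quartic∕quintic surface `4, 9, 24, 55`, quadric∕cubic fourfold `6, 27`).
[cite: EisenbudHarris2016, Example 5.24 and Table 5.1 (held text p0210–p0211)] -/
theorem eulerChar_eq_div_of_even (hYh : IsSmoothHypersurface m e Y) {r : ℕ} (hm : m = 2 * r) (hr : 1 ≤ r) :
    ∑ k ∈ range (2 * m + 1), (-1 : ℤ) ^ k * (Module.finrank ℚ (bettiCohomology Y k) : ℤ) = ((((e - 1) ^ (m + 2) + (e - 1)) / e + m + 1 : ℕ) : ℤ) := by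
  rw [hYh.eulerChar_eq_of_even ⟨r, by omega⟩, hYh.finrank_bettiCohomology_middle_even_eq_div hm hr]
  push_cast
  ring

/-- **`E(Y) ≥ m + 1 − ((d−1)^{m+2} − (d−1))/d` for a smooth hypersurface of ODD dimension** (equality in print: Table 5.1 quadric∕cubic∕quartic∕quintic threefold `4, −6, −56, −200`; the tree has the
one-sided middle Betti number only). [cite: EisenbudHarris2016, Example 5.24 and Table 5.1] -/
theorem le_eulerChar_of_odd (hYh : IsSmoothHypersurface m e Y) {r : ℕ} (hm : m = 2 * r + 1) :
    (m : ℤ) + 1 - ((((e - 1) ^ (m + 2) - (e - 1)) / e : ℕ) : ℤ) ≤ ∑ k ∈ range (2 * m + 1), (-1 : ℤ) ^ k * (Module.finrank ℚ (bettiCohomology Y k) : ℤ) := by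
  rw [hYh.eulerChar_eq_of_odd ⟨r, hm⟩]
  have h := hYh.finrank_bettiCohomology_middle_odd_le_div hm
  omega

/-- **`E(Q) = m + 1` for an odd-dimensional smooth quadric or hyperplane** (`b_m = 0`; quadric threefold `E = 4`). [cite: EisenbudHarris2016, Example 5.24 and Table 5.1] -/
theorem eulerChar_eq_of_odd_of_degree_le_two (hYh : IsSmoothHypersurface m e Y) {r : ℕ} (hm : m = 2 * r + 1) (he : e ≤ 2) :
    ∑ k ∈ range (2 * m + 1), (-1 : ℤ) ^ k * (Module.finrank ℚ (bettiCohomology Y k) : ℤ) = m + 1 := by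
  rw [hYh.eulerChar_eq_of_odd ⟨r, hm⟩, hYh.finrank_bettiCohomology_middle_eq_zero_of_degree_le_two hm he]
  push_cast
  ring

/-- **The cubic fourfold: `E = 27`.** [cite: EisenbudHarris2016, Example 5.24 and Table 5.1] -/
theorem eulerChar_cubicFourfold (hX : IsSmoothHypersurface 4 3 X) : ∑ k ∈ range (2 * 4 + 1), (-1 : ℤ) ^ k * (Module.finrank ℚ (bettiCohomology X k) : ℤ) = 27 := by
  rw [hX.eulerChar_eq_of_even (by decide), hX.finrank_bettiCohomology_four_cubicFourfold]
  norm_num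

/-- The quadric fourfold: `E = 6`. [cite: EisenbudHarris2016, Example 5.24 and Table 5.1] -/
theorem eulerChar_quadricFourfold (hX : IsSmoothHypersurface 4 2 X) : ∑ k ∈ range (2 * 4 + 1), (-1 : ℤ) ^ k * (Module.finrank ℚ (bettiCohomology X k) : ℤ) = 6 := by
  rw [hX.eulerChar_eq_of_even (by decide), hX.finrank_bettiCohomology_four_quadricFourfold]
  norm_num

/-- The cubic surface: `E = 9` (`ℙ²` blown up in six points: `3 + 6`). [cite: EisenbudHarris2016, Example 5.24 and Table 5.1] -/
theorem eulerChar_cubicSurface (hS : IsSmoothHypersurface 2 3 S) : ∑ k ∈ range (2 * 2 + 1), (-1 : ℤ) ^ k * (Module.finrank ℚ (bettiCohomology S k) : ℤ) = 9 := by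
  rw [hS.eulerChar_eq_of_even (by decide), hS.finrank_bettiCohomology_two_surface]
  norm_num

/-- The quartic (K3) surface: `E = 24`. [cite: EisenbudHarris2016, Example 5.24 and Table 5.1] [cite: Huybrechts2016K3, Ch. 1 §2.3] -/
theorem eulerChar_quarticSurface (hS : IsSmoothHypersurface 2 4 S) : ∑ k ∈ range (2 * 2 + 1), (-1 : ℤ) ^ k * (Module.finrank ℚ (bettiCohomology S k) : ℤ) = 24 := by
  rw [hS.eulerChar_eq_of_even (by decide), hS.finrank_bettiCohomology_two_surface]
  norm_num

/-- **A smooth surface of degree `d` in `ℙ³`: `E(S_d) = d³ − 4d² + 6d`.** [cite: EisenbudHarris2016, Example 5.24 and Table 5.1] -/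
theorem eulerChar_surface (hS : IsSmoothHypersurface 2 d S) : ∑ k ∈ range (2 * 2 + 1), (-1 : ℤ) ^ k * (Module.finrank ℚ (bettiCohomology S k) : ℤ) = ((d ^ 3 + 6 * d - 4 * d ^ 2 : ℕ) : ℤ) := by
  rw [hS.eulerChar_eq_of_even (by decide), hS.finrank_bettiCohomology_two_surface]
  have hd := pos_of_isSmoothHypersurface hS
  have h1 : 4 * d ^ 2 + 2 ≤ d ^ 3 + 6 * d := by
    rcases (show d = 1 ∨ d = 2 ∨ d = 3 ∨ 4 ≤ d by omega) with rfl | rfl | rfl | h4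
    · norm_num
    · norm_num
    · norm_num
    · have h5 : 4 * d ^ 2 ≤ d ^ 3 := by
        rw [show d ^ 3 = d * d ^ 2 by ring]
        exact Nat.mul_le_mul_right (d ^ 2) h4
      omega
  have h2 : 4 * d ^ 2 ≤ d ^ 3 + 6 * d := by omega
  push_cast [h1, h2]
  ring

/-- **The cubic threefold: `E ≥ −6`** (`= −6`; `b₃ ≤ 10`). [cite: EisenbudHarris2016, Example 5.24 and Table 5.1] -/
theorem neg_six_le_eulerChar_cubicThreefold (hT : IsSmoothHypersurface 3 3 T) : -6 ≤ ∑ k ∈ range (2 * 3 + 1), (-1 : ℤ) ^ k * (Module.finrank ℚ (bettiCohomology T k) : ℤ) := by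
  have h := hT.le_eulerChar_of_odd (r := 1) rfl
  norm_num at h
  exact h

/-- The quadric threefold: `E = 4`. [cite: EisenbudHarris2016, Example 5.24 and Table 5.1] -/
theorem eulerChar_quadricThreefold (hT : IsSmoothHypersurface 3 2 T) : ∑ k ∈ range (2 * 3 + 1), (-1 : ℤ) ^ k * (Module.finrank ℚ (bettiCohomology T k) : ℤ) = 4 := by
  rw [hT.eulerChar_eq_of_odd_of_degree_le_two (r := 1) rfl le_rfl]
  norm_num

end Euler

end Literature.AlgebraicGeometry.Motives.IsSmoothHypersurface

end
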